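import Literature.Analysis.FluidPDE.WholeSpaceIBP
import Summits.FinalStateConjecture.FinalStateConjecture.Theorems.EIHFluxBalanceModulatedKerrHandoffFarConeGeometry
import Summits.FinalStateConjecture.FinalStateConjecture.Theorems.EIHFluxBalanceModulatedKerrHandoffFarConeFieldBound

/-!
# Far-cone retardation remainder, IV: the transport integral by parts

Support file 4 for the brick `SoftEraTubeLift.FarConeRetardationRemainder` of crux
`EIHFluxBalance.ModulatedKerrHandoff` (H′, stmt-FinalStateConjecture-17402; card `soft-era-tube-lift`).
For a bump `φ ∈ C¹` supported in the unit ball, a centre curve `c ∈ C²` with `c(0) = ξ₀`,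
`‖c′‖ ≤ v < 1`, `‖c″‖ ≤ A`, a deviation `η ∈ C¹` with `‖η(s)‖ ≤ A s²`, `‖η′(s)‖ ≤ A s` (`s ≥ 0`), and
an observer at distance `d = ‖x − ξ₀‖ ≥ 2`, the TRANSPORT INTEGRAL
`J = ∫ Dφ(y − c(s))[η(s)]/s dy` (`s = ‖y − x‖`) — the `λ`-derivative of the retarded integral along
the interpolated centre curves — obeys
`|J| ≤ 3‖φ‖_∞ · (9A + 2A²(d+1)/(1−v))(1−v)⁻² · vol B̄(0, 2/(1−v))` (`abs_integral_transport_le`).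
Proof: `Dφ(z)[η(s)]/s = ⟪U, ∇G⟫` with `G = φ(· − c(‖· − x‖)) ∈ C¹_c` and `U = (1 − χ)F` the
transport field of files II–III cut off near the observer (`χ` a bump at `x` of radii `1/8 < 1/4`,
invisible on the support where `s > 1/2`); whole-space integration by parts
(`Literature.Analysis.FluidPDE.integral_mul_divergence_add_eq_zero_left`) gives `J = −∫ G div U`,
and `|div U| ≤ 3‖DF‖` on the support (file III) with the support geometry of file I.
[folklore]
-/

noncomputable section

open MeasureTheory Set Filter Topology Metric InnerProductSpace Literature.Geometry.Lorentzian
open Literature.Analysis.FluidPDE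
open scoped RealInnerProductSpace

-- the doubled `FinalStateConjecture` path component is the summit/problem naming scheme
set_option linter.dupNamespace false

namespace Summit.FinalStateConjecture.FinalStateConjecture.Theorems.EIHFluxBalance.ModulatedKerrHandoffBricks.FarCone

variable {φ : E3 → ℝ} {c η : ℝ → E3} {x ξ₀ : E3} {v A Φ : ℝ}

/-! ### The retarded bump `G(y) = φ(y − c(‖y − x‖))` is `C¹` with compact support -/

/-- `G` vanishes near the observer (`d > 1`). [folklore] -/
theorem bump_comp_eventuallyEq_zero (hφ0 : ∀ z : E3, 1 ≤ ‖z‖ → φ z = 0) (hc0 : c 0 = ξ₀)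
    (hcv : ∀ s s', ‖c s - c s'‖ ≤ v * |s - s'|) {y : E3}
    (hy : (1 + v) * ‖y - x‖ < ‖x - ξ₀‖ - 1) :
    (fun y' : E3 ↦ φ (y' - c ‖y' - x‖)) =ᶠ[𝓝 y] fun _ ↦ 0 := by
  have hopen : IsOpen {y' : E3 | (1 + v) * ‖y' - x‖ < ‖x - ξ₀‖ - 1} :=
    isOpen_lt (continuous_const.mul (continuous_id.sub continuous_const).norm) continuous_const
  filter_upwards [hopen.mem_nhds hy] with y' hy'
  exact eq_zero_of_retardedDist_le hφ0 hc0 hcv (le_of_lt hy')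

/-- Off the unit ball the derivative of the bump vanishes too. [folklore] -/
theorem fderiv_eq_zero_of_one_lt_norm (hφ0 : ∀ z : E3, 1 ≤ ‖z‖ → φ z = 0) {z : E3}
    (hz : 1 < ‖z‖) : fderiv ℝ φ z = 0 := by
  have h : φ =ᶠ[𝓝 z] fun _ ↦ 0 := by
    filter_upwards [(isOpen_lt continuous_const continuous_norm).mem_nhds hz] with z' hz'
    exact hφ0 z' (le_of_lt hz')
  rw [h.fderiv_eq]
  exact fderiv_const_apply 0

/-- If `(1 + v)‖y − x‖ < d − 1` then the bump's argument is outside the unit ball. [folklore] -/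
theorem one_lt_norm_sub_center (hc0 : c 0 = ξ₀) (hcv : ∀ s s', ‖c s - c s'‖ ≤ v * |s - s'|)
    {y : E3} (hy : (1 + v) * ‖y - x‖ < ‖x - ξ₀‖ - 1) : 1 < ‖y - c ‖y - x‖‖ := by
  by_contra h
  push Not at h
  -- `d ≤ ‖x - y‖ + ‖y - c s‖ + ‖c s - ξ₀‖ ≤ s + 1 + v s`
  have h1 : ‖c ‖y - x‖ - ξ₀‖ ≤ v * ‖y - x‖ := by
    have := hcv ‖y - x‖ 0
    rwa [hc0, sub_zero, abs_of_nonneg (norm_nonneg _)] at this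
  have : ‖x - ξ₀‖ ≤ ‖x - y‖ + ‖y - c ‖y - x‖‖ + ‖c ‖y - x‖ - ξ₀‖ := by
    calc ‖x - ξ₀‖ = ‖(x - y) + (y - c ‖y - x‖) + (c ‖y - x‖ - ξ₀)‖ := by congr 1; abel
      _ ≤ ‖(x - y) + (y - c ‖y - x‖)‖ + ‖c ‖y - x‖ - ξ₀‖ := norm_add_le _ _
      _ ≤ _ := by gcongr; exact norm_add_le _ _
  rw [norm_sub_rev x y] at this
  linarith

/-- **`G ∈ C¹`** (composition away from the observer, zero near it). [folklore] -/
theorem contDiff_bump_comp (hφ : ContDiff ℝ 1 φ) (hφ0 : ∀ z : E3, 1 ≤ ‖z‖ → φ z = 0)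
    (hc : ContDiff ℝ 1 c) (hc0 : c 0 = ξ₀) (hcv : ∀ s s', ‖c s - c s'‖ ≤ v * |s - s'|)
    (hd : 1 < ‖x - ξ₀‖) : ContDiff ℝ 1 fun y : E3 ↦ φ (y - c ‖y - x‖) := by
  refine contDiff_iff_contDiffAt.2 fun y ↦ ?_
  by_cases hyx : y = x
  · subst hyx
    have h0 : (1 + v) * ‖y - y‖ < ‖y - ξ₀‖ - 1 := by simp; linarith
    exact contDiffAt_const.congr_of_eventuallyEq (bump_comp_eventuallyEq_zero hφ0 hc0 hcv h0)
  · have hs : ContDiffAt ℝ 1 (fun y' : E3 ↦ ‖y' - x‖) y :=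
      (contDiffAt_id.sub contDiffAt_const).norm ℝ (sub_ne_zero.2 hyx)
    exact hφ.contDiffAt.comp y (contDiffAt_id.sub (hc.contDiffAt.comp y hs))

/-- **`G` has compact support** (diameter `< 2/(1 − v)`). [folklore] -/
theorem hasCompactSupport_bump_comp (hφ0 : ∀ z : E3, 1 ≤ ‖z‖ → φ z = 0)
    (hcv : ∀ s s', ‖c s - c s'‖ ≤ v * |s - s'|) (hv0 : 0 ≤ v) (hv1 : v < 1) :
    HasCompactSupport fun y : E3 ↦ φ (y - c ‖y - x‖) := by
  by_cases hne : ∃ y₀ : E3, φ (y₀ - c ‖y₀ - x‖) ≠ 0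
  · obtain ⟨y₀, hy₀⟩ := hne
    refine HasCompactSupport.intro (isCompact_closedBall y₀ (2 / (1 - v))) fun y hy ↦ ?_
    by_contra h
    have := retarded_support_diam (x := x) hcv hv0 hv1 (norm_lt_one_of_ne_zero hφ0 hy₀)
      (norm_lt_one_of_ne_zero hφ0 h)
    exact hy (mem_closedBall.2 (by rw [dist_eq_norm, norm_sub_rev]; exact this.le))
  · push Not at hne
    have : (fun y : E3 ↦ φ (y - c ‖y - x‖)) = 0 := funext fun y ↦ hne y
    rw [this]
    exact HasCompactSupport.zero

/-! ### The cut-off transport field `U = (1 − χ) F` -/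

section Cutoff

variable (χ : ContDiffBump x)

/-- **`U ∈ C¹`**: zero near the observer, and the field of file II elsewhere. [folklore] -/
theorem contDiff_cutoff_field (hc : ContDiff ℝ 2 c) (hη : ContDiff ℝ 1 η)
    (hcv : ∀ s, ‖deriv c s‖ ≤ v) (hv1 : v < 1) :
    ContDiff ℝ 1 fun y : E3 ↦ (1 - χ y) • ((‖y - x‖)⁻¹ • η ‖y - x‖ +
      (⟪(‖y - x‖)⁻¹ • (y - x), η ‖y - x‖⟫ *
        (‖y - x‖ * (1 - ⟪(‖y - x‖)⁻¹ • (y - x), deriv c ‖y - x‖⟫))⁻¹) • deriv c ‖y - x‖) := by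
  refine contDiff_iff_contDiffAt.2 fun y ↦ ?_
  by_cases hy : dist y x < χ.rIn
  · -- `χ = 1` near `y`, so the field vanishes near `y`
    have hev : (fun y' : E3 ↦ (1 - χ y') • ((‖y' - x‖)⁻¹ • η ‖y' - x‖ +
        (⟪(‖y' - x‖)⁻¹ • (y' - x), η ‖y' - x‖⟫ *
          (‖y' - x‖ * (1 - ⟪(‖y' - x‖)⁻¹ • (y' - x), deriv c ‖y' - x‖⟫))⁻¹) • deriv c ‖y' - x‖)) =ᶠ[𝓝 y]
        fun _ ↦ 0 := by
      filter_upwards [Metric.ball_mem_nhds y (sub_pos.2 hy)] with y' hy'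
      have : χ y' = 1 := χ.one_of_mem_closedBall (mem_closedBall.2 (by
        have := dist_triangle y' y x
        rw [mem_ball] at hy'
        linarith))
      simp [this]
    exact contDiffAt_const.congr_of_eventuallyEq hev
  · push Not at hy
    have hyx : y ≠ x := by
      intro h; rw [h, dist_self] at hy; exact (not_lt.2 hy) χ.rIn_pos
    have hpos : 0 < ‖y - x‖ := norm_pos_iff.2 (sub_ne_zero.2 hyx)
    have hden : ⟪(‖y - x‖)⁻¹ • (y - x), deriv c ‖y - x‖⟫ ≠ 1 := by
      have h1 : |⟪(‖y - x‖)⁻¹ • (y - x), deriv c ‖y - x‖⟫| ≤ v := by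
        refine (abs_real_inner_le_norm _ _).trans ?_
        rw [norm_smul, norm_inv, norm_norm, inv_mul_cancel₀ hpos.ne', one_mul]
        exact hcv _
      intro h
      rw [h, abs_one] at h1
      linarith
    exact (contDiffAt_const.sub χ.contDiff.contDiffAt).smul (contDiffAt_field hc hη hyx hden)

end Cutoff

/-! ### The pointwise identity `⟪U, ∇G⟫ = Dφ(z)[η(s)]/s` -/

section Identity

variable (χ : ContDiffBump x)

/-- **`⟪U(y), ∇G(y)⟫ = Dφ(z)[η(s)]/s` everywhere**, provided the cut-off radius `χ.rOut` is at most
`(d − 1)/(1 + v)`: near the observer both sides vanish, elsewhere `χ = 0` and the Sherman–Morrison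
identity of file II applies. [folklore] -/
theorem inner_cutoff_field_gradient (hφ : ContDiff ℝ 1 φ) (hφ0 : ∀ z : E3, 1 ≤ ‖z‖ → φ z = 0)
    (hc : ContDiff ℝ 1 c) (hc0 : c 0 = ξ₀) (hcv : ∀ s, ‖deriv c s‖ ≤ v) (hv0 : 0 ≤ v) (hv1 : v < 1)
    (hχ : (1 + v) * χ.rOut ≤ ‖x - ξ₀‖ - 1) (y : E3) :
    ⟪(1 - χ y) • ((‖y - x‖)⁻¹ • η ‖y - x‖ +
      (⟪(‖y - x‖)⁻¹ • (y - x), η ‖y - x‖⟫ *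
        (‖y - x‖ * (1 - ⟪(‖y - x‖)⁻¹ • (y - x), deriv c ‖y - x‖⟫))⁻¹) • deriv c ‖y - x‖),
      gradient (fun y' : E3 ↦ φ (y' - c ‖y' - x‖)) y⟫ =
      (‖y - x‖)⁻¹ * fderiv ℝ φ (y - c ‖y - x‖) (η ‖y - x‖) := by
  have hcd : Differentiable ℝ c := hc.differentiable one_ne_zero
  have hcv' : ∀ s s', ‖c s - c s'‖ ≤ v * |s - s'| := norm_sub_le_of_speed hcd hcv
  by_cases hy : (1 + v) * ‖y - x‖ < ‖x - ξ₀‖ - 1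
  · -- both sides vanish
    have hG : gradient (fun y' : E3 ↦ φ (y' - c ‖y' - x‖)) y = 0 := by
      rw [gradient, (bump_comp_eventuallyEq_zero hφ0 hc0 hcv' hy).fderiv_eq, fderiv_const_apply,
        map_zero]
    rw [hG, inner_zero_right, fderiv_eq_zero_of_one_lt_norm hφ0 (one_lt_norm_sub_center hc0 hcv' hy),
      zero_apply, mul_zero]
  · -- away from the observer: `χ y = 0`
    push Not at hy
    have hs : χ.rOut ≤ ‖y - x‖ := by
      by_contra h
      push Not at h
      have : (1 + v) * ‖y - x‖ < (1 + v) * χ.rOut := mul_lt_mul_of_pos_left h (by linarith)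
      linarith
    have hχ0 : χ y = 0 := χ.zero_of_le_dist (by rwa [dist_eq_norm])
    have hyx : y ≠ x := by
      intro h
      rw [h, sub_self, norm_zero] at hs
      linarith [χ.rOut_pos]
    have hpos : 0 < ‖y - x‖ := norm_pos_iff.2 (sub_ne_zero.2 hyx)
    have hden : ⟪(‖y - x‖)⁻¹ • (y - x), deriv c ‖y - x‖⟫ ≠ 1 := by
      have h1 : |⟪(‖y - x‖)⁻¹ • (y - x), deriv c ‖y - x‖⟫| ≤ v := by
        refine (abs_real_inner_le_norm _ _).trans ?_
        rw [norm_smul, norm_inv, norm_norm, inv_mul_cancel₀ hpos.ne', one_mul]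
        exact hcv _
      intro h
      rw [h, abs_one] at h1
      linarith
    rw [hχ0, sub_zero, one_smul, real_inner_comm, inner_gradient_left,
      fderiv_bump_comp_apply_field (hφ.differentiable one_ne_zero) hcd hyx hden]

end Identity

/-! ### The divergence of `U` on the support -/

/-- `|tr L| ≤ 3K` for an endomorphism of `E3` with `‖L w‖ ≤ K‖w‖`. [folklore] -/
theorem abs_sum_inner_le {L : E3 →L[ℝ] E3} {K : ℝ} (hL : ∀ w, ‖L w‖ ≤ K * ‖w‖) :
    |∑ i, ⟪(EuclideanSpace.basisFun (Fin 3) ℝ) i, L ((EuclideanSpace.basisFun (Fin 3) ℝ) i)⟫| ≤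
      3 * K := by
  calc |∑ i, ⟪(EuclideanSpace.basisFun (Fin 3) ℝ) i, L ((EuclideanSpace.basisFun (Fin 3) ℝ) i)⟫|
      ≤ ∑ i, |⟪(EuclideanSpace.basisFun (Fin 3) ℝ) i, L ((EuclideanSpace.basisFun (Fin 3) ℝ) i)⟫| :=
        Finset.abs_sum_le_sum_abs _ _
    _ ≤ ∑ _i : Fin 3, K := Finset.sum_le_sum fun i _ ↦ by
        refine (abs_real_inner_le_norm _ _).trans ?_
        have h1 : ‖(EuclideanSpace.basisFun (Fin 3) ℝ) i‖ = 1 :=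
          (EuclideanSpace.basisFun (Fin 3) ℝ).orthonormal.1 i
        calc ‖(EuclideanSpace.basisFun (Fin 3) ℝ) i‖ * ‖L ((EuclideanSpace.basisFun (Fin 3) ℝ) i)‖
            = ‖L ((EuclideanSpace.basisFun (Fin 3) ℝ) i)‖ := by rw [h1, one_mul]
          _ ≤ K * ‖(EuclideanSpace.basisFun (Fin 3) ℝ) i‖ := hL _
          _ = K := by rw [h1, mul_one]
    _ = 3 * K := by simp

/-- **Divergence bound on the support.** At a point `y` with `χ.rOut < ‖y − x‖` (so `U = F`
near `y`), `|div U(y)| ≤ 3 (9A + 2A²s)(1 − v)⁻²`. [folklore] -/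
theorem abs_divergence_cutoff_field_le (χ : ContDiffBump x) (hc : ContDiff ℝ 2 c)
    (hη : ContDiff ℝ 1 η) (hv0 : 0 ≤ v) (hv1 : v < 1) (hA : 0 ≤ A) (hcv : ∀ s, ‖deriv c s‖ ≤ v)
    (hcA : ∀ s, ‖deriv (deriv c) s‖ ≤ A) {y : E3} (hηA : ‖η ‖y - x‖‖ ≤ A * ‖y - x‖ ^ 2)
    (hη'A : ‖deriv η ‖y - x‖‖ ≤ A * ‖y - x‖) (hy : χ.rOut < ‖y - x‖) :
    |VectorCalculus.divergence (fun y' : E3 ↦ (1 - χ y') • ((‖y' - x‖)⁻¹ • η ‖y' - x‖ +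
      (⟪(‖y' - x‖)⁻¹ • (y' - x), η ‖y' - x‖⟫ *
        (‖y' - x‖ * (1 - ⟪(‖y' - x‖)⁻¹ • (y' - x), deriv c ‖y' - x‖⟫))⁻¹) • deriv c ‖y' - x‖)) y| ≤
      3 * ((9 * A + 2 * A ^ 2 * ‖y - x‖) / (1 - v) ^ 2) := by
  have hyx : y ≠ x := by
    intro h
    rw [h, sub_self, norm_zero] at hy
    linarith [χ.rOut_pos]
  obtain ⟨L, hL, hLle⟩ := exists_hasFDerivAt_field_bound hc hη hv0 hv1 hA hcv hcA hηA hη'A hyx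
  -- near `y` the cut-off is invisible
  have hev : (fun y' : E3 ↦ (1 - χ y') • ((‖y' - x‖)⁻¹ • η ‖y' - x‖ +
      (⟪(‖y' - x‖)⁻¹ • (y' - x), η ‖y' - x‖⟫ *
        (‖y' - x‖ * (1 - ⟪(‖y' - x‖)⁻¹ • (y' - x), deriv c ‖y' - x‖⟫))⁻¹) • deriv c ‖y' - x‖)) =ᶠ[𝓝 y]
      fun y' : E3 ↦ (‖y' - x‖)⁻¹ • η ‖y' - x‖ +
        (⟪(‖y' - x‖)⁻¹ • (y' - x), η ‖y' - x‖⟫ *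
          (‖y' - x‖ * (1 - ⟪(‖y' - x‖)⁻¹ • (y' - x), deriv c ‖y' - x‖⟫))⁻¹) • deriv c ‖y' - x‖ := by
    have hopen : IsOpen {y' : E3 | χ.rOut < ‖y' - x‖} :=
      isOpen_lt continuous_const (continuous_id.sub continuous_const).norm
    filter_upwards [hopen.mem_nhds hy] with y' hy'
    have : χ y' = 0 := χ.zero_of_le_dist (by rw [dist_eq_norm]; exact le_of_lt hy')
    rw [this, sub_zero, one_smul]
  rw [divergence_eq_sum_inner_fderiv (EuclideanSpace.basisFun (Fin 3) ℝ), hev.fderiv_eq, hL.fderiv]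
  exact abs_sum_inner_le hLle

/-! ### The transport integral -/

/-- **The transport integral by parts.** For `φ ∈ C¹` supported in the unit ball with
`|φ| ≤ Φ`, a centre curve `c ∈ C²` (`c(0) = ξ₀`, `‖c′‖ ≤ v < 1`, `‖c″‖ ≤ A`), a deviation `η ∈ C¹`
(`‖η(s)‖ ≤ A s²`, `‖η′(s)‖ ≤ A s` for `s ≥ 0`) and an observer with `d = ‖x − ξ₀‖ ≥ 2`:
`|∫ Dφ(y − c(s))[η(s)]/s dy| ≤ 3Φ (9A + 2A²(d+1)/(1−v))(1−v)⁻² vol B̄(0, 2/(1−v))`. [folklore] -/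
theorem abs_integral_transport_le (hφ : ContDiff ℝ 1 φ) (hφ0 : ∀ z : E3, 1 ≤ ‖z‖ → φ z = 0)
    (hΦ : ∀ z, |φ z| ≤ Φ) (hc : ContDiff ℝ 2 c) (hη : ContDiff ℝ 1 η) (hc0 : c 0 = ξ₀)
    (hcv : ∀ s, ‖deriv c s‖ ≤ v) (hcA : ∀ s, ‖deriv (deriv c) s‖ ≤ A)
    (hηA : ∀ s, 0 ≤ s → ‖η s‖ ≤ A * s ^ 2) (hη'A : ∀ s, 0 ≤ s → ‖deriv η s‖ ≤ A * s)
    (hv0 : 0 ≤ v) (hv1 : v < 1) (hA : 0 ≤ A) (hd : 2 ≤ ‖x - ξ₀‖) :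
    |∫ y : E3, (‖y - x‖)⁻¹ * fderiv ℝ φ (y - c ‖y - x‖) (η ‖y - x‖)| ≤
      Φ * (3 * ((9 * A + 2 * A ^ 2 * ((‖x - ξ₀‖ + 1) / (1 - v))) / (1 - v) ^ 2)) *
        (volume (closedBall (0 : E3) (2 / (1 - v)))).toReal := by
  have hΦ0 : 0 ≤ Φ := (abs_nonneg _).trans (hΦ 0)
  have h1v : 0 < 1 - v := by linarith
  have hd1 : 1 < ‖x - ξ₀‖ := by linarith
  have hcd : Differentiable ℝ c := hc.differentiable two_ne_zero
  have hcv' : ∀ s s', ‖c s - c s'‖ ≤ v * |s - s'| := norm_sub_le_of_speed hcd hcv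
  -- the cut-off at the observer, radii `1/8 < 1/4 ≤ (d - 1)/(1 + v)`
  let χ : ContDiffBump x := ⟨1 / 8, 1 / 4, by norm_num, by norm_num⟩
  have hχ : (1 + v) * χ.rOut ≤ ‖x - ξ₀‖ - 1 := by
    show (1 + v) * (1 / 4) ≤ ‖x - ξ₀‖ - 1
    linarith
  -- names
  set G : E3 → ℝ := fun y' ↦ φ (y' - c ‖y' - x‖) with hG
  set U : E3 → E3 := fun y ↦ (1 - χ y) • ((‖y - x‖)⁻¹ • η ‖y - x‖ +
      (⟪(‖y - x‖)⁻¹ • (y - x), η ‖y - x‖⟫ *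
        (‖y - x‖ * (1 - ⟪(‖y - x‖)⁻¹ • (y - x), deriv c ‖y - x‖⟫))⁻¹) • deriv c ‖y - x‖) with hU
  have hGc1 : ContDiff ℝ 1 G := contDiff_bump_comp hφ hφ0 (hc.of_le one_le_two) hc0 hcv' hd1
  have hGc : HasCompactSupport G := hasCompactSupport_bump_comp hφ0 hcv' hv0 hv1
  have hUc1 : ContDiff ℝ 1 U := contDiff_cutoff_field χ hc hη hcv hv1
  -- integration by parts
  have hibp := integral_mul_divergence_add_eq_zero_left hGc1 hUc1 hGc
  have hid : (fun y : E3 ↦ (‖y - x‖)⁻¹ * fderiv ℝ φ (y - c ‖y - x‖) (η ‖y - x‖)) =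
      fun y ↦ ⟪U y, gradient G y⟫ :=
    funext fun y ↦ (inner_cutoff_field_gradient χ hφ hφ0 (hc.of_le one_le_two) hc0 hcv hv0 hv1
      hχ y).symm
  have hJ : ∫ y : E3, (‖y - x‖)⁻¹ * fderiv ℝ φ (y - c ‖y - x‖) (η ‖y - x‖) =
      -∫ y, G y * VectorCalculus.divergence U y := by
    rw [hid]; linarith
  rw [hJ, abs_neg]
  -- the pointwise bound on the support
  set K : ℝ := 3 * ((9 * A + 2 * A ^ 2 * ((‖x - ξ₀‖ + 1) / (1 - v))) / (1 - v) ^ 2) with hK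
  have hK0 : 0 ≤ K := by positivity
  have hpt : ∀ y, |G y * VectorCalculus.divergence U y| ≤ Φ * K := by
    intro y
    by_cases hGy : G y = 0
    · rw [hGy, zero_mul, abs_zero]; positivity
    · have hlt1 : ‖y - c ‖y - x‖‖ < 1 := norm_lt_one_of_ne_zero hφ0 hGy
      have hslo : (‖x - ξ₀‖ - 1) / (1 + v) < ‖y - x‖ := lt_retardedDist hc0 hcv' hv0 hlt1
      have hshi : ‖y - x‖ < (‖x - ξ₀‖ + 1) / (1 - v) := retardedDist_lt hc0 hcv' hv1 hlt1
      have hs0 : 0 ≤ ‖y - x‖ := norm_nonneg _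
      have hrout : χ.rOut < ‖y - x‖ := by
        refine lt_of_le_of_lt ?_ hslo
        rw [le_div_iff₀ (by linarith)]
        linarith
      have hdiv := abs_divergence_cutoff_field_le χ hc hη hv0 hv1 hA hcv hcA (hηA _ hs0) (hη'A _ hs0)
        hrout
      rw [abs_mul]
      refine mul_le_mul (hΦ _) (hdiv.trans ?_) (abs_nonneg _) hΦ0
      rw [hK]
      gcongr
  -- integrate over the support ball
  by_cases hne : ∃ y₀ : E3, G y₀ ≠ 0
  · obtain ⟨y₀, hy₀⟩ := hne
    set B := closedBall y₀ (2 / (1 - v)) with hB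
    have hvol : volume B = volume (closedBall (0 : E3) (2 / (1 - v))) := by
      rw [hB, Measure.addHaar_closedBall_center]
    have hout : ∀ y ∉ B, G y * VectorCalculus.divergence U y = 0 := by
      intro y hy
      have hGy : G y = 0 := by
        by_contra h
        have := retarded_support_diam (x := x) hcv' hv0 hv1 (norm_lt_one_of_ne_zero hφ0 hy₀)
          (norm_lt_one_of_ne_zero hφ0 h)
        exact hy (mem_closedBall.2 (by rw [dist_eq_norm, norm_sub_rev]; exact this.le))
      rw [hGy, zero_mul]
    rw [← setIntegral_eq_integral_of_forall_compl_eq_zero hout, ← hvol, ← Real.norm_eq_abs]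
    calc ‖∫ y in B, G y * VectorCalculus.divergence U y‖ ≤ (Φ * K) * (volume B).toReal := by
          rw [← measureReal_def]
          exact norm_setIntegral_le_of_norm_le_const measure_closedBall_lt_top fun y _ ↦ by
            rw [Real.norm_eq_abs]; exact hpt y
      _ = Φ * K * (volume B).toReal := rfl
  · push Not at hne
    have : (fun y ↦ G y * VectorCalculus.divergence U y) = fun _ ↦ 0 := by
      funext y; rw [hne y, zero_mul]
    rw [this, integral_zero, abs_zero]
    positivity

/-! ### Registered form -/

/-- **The transport integral by parts** (registered helper of stmt-FinalStateConjecture-17402, brick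
`FarConeRetardationRemainder`). [folklore] -/
theorem farCone_abs_integral_transport_le : ∀ (φ : EuclideanSpace ℝ (Fin 3) → ℝ) (c η : ℝ → EuclideanSpace ℝ (Fin 3)) (x ξ₀ : EuclideanSpace ℝ (Fin 3)) (v A Φ : ℝ), ContDiff ℝ 1 φ → (∀ z, 1 ≤ ‖z‖ → φ z = 0) → (∀ z, |φ z| ≤ Φ) → ContDiff ℝ 2 c → ContDiff ℝ 1 η → c 0 = ξ₀ → (∀ s, ‖deriv c s‖ ≤ v) → (∀ s, ‖deriv (deriv c) s‖ ≤ A) → (∀ s, 0 ≤ s → ‖η s‖ ≤ A * s ^ 2) → (∀ s, 0 ≤ s → ‖deriv η s‖ ≤ A * s) → 0 ≤ v → v < 1 → 0 ≤ A → 2 ≤ ‖x - ξ₀‖ → |MeasureTheory.integral MeasureTheory.volume (fun y : EuclideanSpace ℝ (Fin 3) ↦ (‖y - x‖)⁻¹ * fderiv ℝ φ (y - c ‖y - x‖) (η ‖y - x‖))| ≤ Φ * (3 * ((9 * A + 2 * A ^ 2 * ((‖x - ξ₀‖ + 1) / (1 - v))) / (1 - v) ^ 2)) * (MeasureTheory.volume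 (Metric.closedBall (0 : EuclideanSpace ℝ (Fin 3)) (2 / (1 - v)))).toReal :=
  fun _φ _c _η _x _ξ₀ _v _A _Φ hφ hφ0 hΦ hc hη hc0 hcv hcA hηA hη'A hv0 hv1 hA hd ↦
    abs_integral_transport_le hφ hφ0 hΦ hc hη hc0 hcv hcA hηA hη'A hv0 hv1 hA hd

end Summit.FinalStateConjecture.FinalStateConjecture.Theorems.EIHFluxBalance.ModulatedKerrHandoffBricks.FarCone

end
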